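import Summits.Ventures.PercRepro.GenQBalance
import Summits.Ventures.PercRepro.PlaneCore

/-!
# PercRepro — C-025 at `(q + 2, q)`: «hyperplane + two points» at the top type recurses to the top type one level
down (night-4, gen 0)

The `(6, 4)` piece `PlaneAddTwoFour` (Theorem 21.6 at `t = 4`: `0 ≤ J₄(G)` when `G = τ ⊔ {a, a′}` with `τ` a plane
trace) was closed by p1 with per-profile tables.  Here is its STRUCTURAL content at every level, with no table: for a
rank-`q` set `τ` and two points `a, a′ ∉ cl(τ)` with `G = τ ∪ {a, a′}` of rank `q + 1`,

* the demanding rank-`(q + 1)` subsets of `G` at the top type are exactly `B″ ∪ {a}` and `B″ ∪ {a′}` over the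
  demanding rank-`q` subsets `B″` of `τ` at ITS top type (`demand_subset_images`: `#U_{q+1}(G) ≤ 2·#U_q(τ)`);
* the supply of `G` dominates twice the supply of `τ`: `w_∞(B″ ∪ {a}) ≥ w_∞(B″)/2` (one more coloop),
  `w_∞(B″ ∪ {a, a′}) ≥ w_∞(B″)` (`a, a′` are not coloops of `B″ ∪ {a, a′}`), so the three sets over `B″` supply
  `≥ 4·w_∞(B″)` (`supply_ge_two_mul`);
* `Φ(q + 3, q + 1) ≤ Φ(q + 2, q)`.

Hence **`two_mul_Jq_le_Jq_hyp_add_two`**: `2 · Jq M τ q q ≤ Jq M G (q + 1) (q + 1)` — the top-type balance of a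
«hyperplane + two points» set at level `q + 1` follows from the top-type balance of the hyperplane trace at level
`q`.  At `q = 3` the right side is `J₄(G)` for a plane + two points and the left side is the per-plane balance of the
`(5, 3)` row at its top type (Theorem O's hard max-trace on planes): `PlaneAddTwoFour` is the `(5, 3)` top type in
disguise, and in general the plane-add piece of level `q + 1` is the top-type balance of level `q`.
-/

namespace PercRepro.GenQ

open Finset ThmH SixFour

variable {α : Type*} [DecidableEq α] {M : Matroid α} [M.Finite]

/-! ## Coloops under one or two added points -/

omit [M.Finite] in
/-- `q + 1 ≤ q` is false in `ℕ∞` (local copy). -/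
theorem enat_succ_not_le (q : ℕ) : ¬ ((q : ℕ∞) + 1 ≤ (q : ℕ∞)) := by
  intro h
  have h' : ((q + 1 : ℕ) : ℕ∞) ≤ (q : ℕ∞) := by
    push_cast
    exact h
  have := (Nat.cast_le (α := ℕ∞)).1 h'
  omega

/-- A coloop of `M|(B ∪ {a})` lying in `B` is a coloop of `M|B`. -/
theorem coloopsOf_insert_subset (B : Finset α) (a : α) :
    coloopsOf M (insert a B) ⊆ insert a (coloopsOf M B) := by
  intro y hy
  rw [mem_coloopsOf] at hy
  rw [Finset.mem_insert]
  by_cases hya : y = a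
  · exact Or.inl hya
  · right
    rw [mem_coloopsOf]
    refine ⟨(Finset.mem_insert.1 hy.1).resolve_left hya, fun h => hy.2 ?_⟩
    refine M.closure_subset_closure (Finset.coe_subset.2 ?_) h
    intro x hx
    rw [Finset.mem_erase] at hx ⊢
    exact ⟨hx.1, Finset.mem_insert_of_mem hx.2⟩

/-- `m(B ∪ {a}) ≤ m(B) + 1`. -/
theorem mTr_insert_le (B : Finset α) (a : α) : mTr M (insert a B) ≤ mTr M B + 1 := by
  unfold mTr
  exact (Finset.card_le_card (coloopsOf_insert_subset B a)).trans (Finset.card_insert_le _ _)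

/-- A point `a ∈ E` that does not raise the rank of `X` lies in its closure. -/
theorem mem_closure_of_eRk_insert_le {X : Finset α} {a : α} (ha : a ∈ gr M)
    (h : M.eRk ((insert a X : Finset α) : Set α) ≤ M.eRk (X : Set α)) : a ∈ M.closure (X : Set α) := by
  by_contra hcl
  have haE : a ∈ M.E := by
    rw [← coe_gr M]
    exact_mod_cast ha
  have h1 := Matroid.eRk_insert_eq_add_one (M := M) (e := a) (X := (X : Set α)) ⟨haE, hcl⟩
  rw [Finset.coe_insert] at h
  rw [h1] at h
  obtain ⟨k, hk, -⟩ := eRk_eq_nat M X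
  rw [hk] at h
  exact enat_succ_not_le k h

/-- If neither added point raises the rank of the other's insertion, the coloops of `M|(B ∪ {a, a′})` are coloops
of `M|B`: `m(B ∪ {a, a′}) ≤ m(B)`. -/
theorem mTr_insert_insert_le {B : Finset α} {a a' : α} (ha : a ∈ gr M) (ha' : a' ∈ gr M) (hne : a ≠ a')
    (haB : a ∉ B) (ha'B : a' ∉ B)
    (h1 : M.eRk ((insert a (insert a' B) : Finset α) : Set α) ≤ M.eRk ((insert a' B : Finset α) : Set α))
    (h2 : M.eRk ((insert a (insert a' B) : Finset α) : Set α) ≤ M.eRk ((insert a B : Finset α) : Set α)) :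
    mTr M (insert a (insert a' B)) ≤ mTr M B := by
  unfold mTr
  apply Finset.card_le_card
  intro y hy
  rw [mem_coloopsOf] at hy ⊢
  have hacl : a ∈ M.closure ((insert a' B : Finset α) : Set α) := mem_closure_of_eRk_insert_le ha h1
  have ha'cl : a' ∈ M.closure ((insert a B : Finset α) : Set α) := by
    apply mem_closure_of_eRk_insert_le ha'
    rw [Finset.insert_comm]
    exact h2
  have hya : y ≠ a := by
    rintro rfl
    apply hy.2
    rw [Finset.erase_insert (by
      rw [Finset.mem_insert]
      rintro (h | h)
      · exact hne h
      · exact haB h)]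
    exact hacl
  have hya' : y ≠ a' := by
    rintro rfl
    apply hy.2
    rw [Finset.insert_comm, Finset.erase_insert (by
      rw [Finset.mem_insert]
      rintro (h | h)
      · exact hne h.symm
      · exact ha'B h)]
    exact ha'cl
  have hyB : y ∈ B := by
    rcases Finset.mem_insert.1 hy.1 with h | h
    · exact absurd h hya
    · rcases Finset.mem_insert.1 h with h' | h'
      · exact absurd h' hya'
      · exact h'
  refine ⟨hyB, fun h => hy.2 ?_⟩
  refine M.closure_subset_closure (Finset.coe_subset.2 ?_) h
  intro x hx
  rw [Finset.mem_erase] at hx ⊢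
  exact ⟨hx.1, Finset.mem_insert_of_mem (Finset.mem_insert_of_mem hx.2)⟩

/-! ## The setting: `G = τ ∪ {a, a′}` -/

section HypAddTwo

variable {τ : Finset α} {a a' : α} {q : ℕ}

/-- The rank of `B″ ∪ {a}` for `B″ ⊆ τ` of rank `q` and `a ∉ cl(τ)`. -/
theorem eRk_insert_of_notMem_closure (ha : a ∈ gr M) (hacl : a ∉ M.closure (τ : Set α)) {B : Finset α}
    (hB : B ⊆ τ) (hr : M.eRk (B : Set α) = (q : ℕ∞)) :
    M.eRk ((insert a B : Finset α) : Set α) = (q : ℕ∞) + 1 := by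
  have haE : a ∈ M.E := by
    rw [← coe_gr M]
    exact_mod_cast ha
  have hcl : a ∉ M.closure (B : Set α) := fun h =>
    hacl (M.closure_subset_closure (Finset.coe_subset.2 hB) h)
  rw [Finset.coe_insert, Matroid.eRk_insert_eq_add_one ⟨haE, hcl⟩, hr]

/-- **Supply dominates twice the supply of the trace**: over `B″ ∈ R_q(τ)` the sets `B″ ∪ {a}`, `B″ ∪ {a′}`,
`B″ ∪ {a, a′}` are distinct rank-`(q + 1)` subsets of `G` with `w_∞ ≥ w_∞(B″)/2, w_∞(B″)/2, w_∞(B″)`. -/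
theorem supply_ge_two_mul (hG : τ ⊆ gr M) (ha : a ∈ gr M) (ha' : a' ∈ gr M) (hne : a ≠ a')
    (haτ : a ∉ τ) (ha'τ : a' ∉ τ) (hacl : a ∉ M.closure (τ : Set α)) (ha'cl : a' ∉ M.closure (τ : Set α))
    (hrG : M.eRk ((insert a (insert a' τ) : Finset α) : Set α) = (q : ℕ∞) + 1) :
    ∑ B ∈ Rq M τ q, 4 * wInf M B ≤ ∑ B ∈ Rq M (insert a (insert a' τ)) (q + 1), 2 * wInf M B := by
  classical
  set G := insert a (insert a' τ) with hGdef
  set f₁ : Finset α → Finset α := fun B => insert a B with hf₁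
  set f₂ : Finset α → Finset α := fun B => insert a' B with hf₂
  set f₃ : Finset α → Finset α := fun B => insert a (insert a' B) with hf₃
  have hτG : τ ⊆ G := (Finset.subset_insert _ _).trans (Finset.subset_insert _ _)
  have hGg : G ⊆ gr M := Finset.insert_subset ha (Finset.insert_subset ha' hG)
  -- membership of the three images in `R_{q+1}(G)`
  have hm₁ : ∀ B ∈ Rq M τ q, f₁ B ∈ Rq M G (q + 1) := by
    intro B hB
    rw [mem_Rq] at hB ⊢
    refine ⟨Finset.insert_subset (Finset.mem_insert_self _ _) (hB.1.trans hτG), ?_⟩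
    rw [eRk_insert_of_notMem_closure ha hacl hB.1 hB.2]
    push_cast
    rfl
  have hm₂ : ∀ B ∈ Rq M τ q, f₂ B ∈ Rq M G (q + 1) := by
    intro B hB
    rw [mem_Rq] at hB ⊢
    refine ⟨Finset.insert_subset (Finset.mem_insert_of_mem (Finset.mem_insert_self _ _))
      (hB.1.trans hτG), ?_⟩
    rw [eRk_insert_of_notMem_closure ha' ha'cl hB.1 hB.2]
    push_cast
    rfl
  have hm₃ : ∀ B ∈ Rq M τ q, f₃ B ∈ Rq M G (q + 1) := by
    intro B hB
    rw [mem_Rq] at hB ⊢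
    have hsub : f₃ B ⊆ G := by
      intro x hx
      rw [hf₃] at hx
      simp only [Finset.mem_insert] at hx
      rw [hGdef]
      simp only [Finset.mem_insert]
      rcases hx with h | h | h
      · exact Or.inl h
      · exact Or.inr (Or.inl h)
      · exact Or.inr (Or.inr (hB.1 h))
    refine ⟨hsub, le_antisymm ?_ ?_⟩
    · push_cast
      rw [← hrG]
      exact M.eRk_mono (Finset.coe_subset.2 hsub)
    · push_cast
      rw [← eRk_insert_of_notMem_closure ha' ha'cl hB.1 hB.2]
      exact M.eRk_mono (Finset.coe_subset.2 (Finset.subset_insert _ _))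
  -- injectivity
  have hinj₁ : Set.InjOn f₁ ((Rq M τ q : Finset (Finset α)) : Set (Finset α)) := by
    intro B hB B' hB' h
    rw [Finset.mem_coe, mem_Rq] at hB hB'
    have := congrArg (fun S => S.erase a) h
    simp only [hf₁] at this
    rwa [Finset.erase_insert (fun h => haτ (hB.1 h)), Finset.erase_insert (fun h => haτ (hB'.1 h))] at this
  have hinj₂ : Set.InjOn f₂ ((Rq M τ q : Finset (Finset α)) : Set (Finset α)) := by
    intro B hB B' hB' h
    rw [Finset.mem_coe, mem_Rq] at hB hB'
    have := congrArg (fun S => S.erase a') h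
    simp only [hf₂] at this
    rwa [Finset.erase_insert (fun h => ha'τ (hB.1 h)), Finset.erase_insert (fun h => ha'τ (hB'.1 h))] at this
  have hinj₃ : Set.InjOn f₃ ((Rq M τ q : Finset (Finset α)) : Set (Finset α)) := by
    intro B hB B' hB' h
    rw [Finset.mem_coe, mem_Rq] at hB hB'
    have h1 := congrArg (fun S => (S.erase a).erase a') h
    simp only [hf₃] at h1
    have e : ∀ C : Finset α, C ⊆ τ → ((insert a (insert a' C)).erase a).erase a' = C := by
      intro C hC
      rw [Finset.erase_insert (by
        rw [Finset.mem_insert]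
        rintro (h | h)
        · exact hne h
        · exact haτ (hC h)), Finset.erase_insert (fun h => ha'τ (hC h))]
    rwa [e B hB.1, e B' hB'.1] at h1
  -- the three images are pairwise disjoint
  have hd₁₂ : Disjoint ((Rq M τ q).image f₁) ((Rq M τ q).image f₂) := by
    rw [Finset.disjoint_left]
    intro S h1 h2
    rw [Finset.mem_image] at h1 h2
    obtain ⟨B, hB, rfl⟩ := h1
    obtain ⟨B', hB', hB'eq⟩ := h2
    rw [mem_Rq] at hB hB'
    have : a ∈ f₂ B' := by
      rw [hB'eq]
      exact Finset.mem_insert_self _ _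
    rw [hf₂] at this
    rcases Finset.mem_insert.1 this with h | h
    · exact hne h
    · exact haτ (hB'.1 h)
  have hd₁₃ : Disjoint ((Rq M τ q).image f₁) ((Rq M τ q).image f₃) := by
    rw [Finset.disjoint_left]
    intro S h1 h2
    rw [Finset.mem_image] at h1 h2
    obtain ⟨B, hB, rfl⟩ := h1
    obtain ⟨B', hB', hB'eq⟩ := h2
    rw [mem_Rq] at hB hB'
    have : a' ∈ f₁ B := by
      rw [← hB'eq, hf₃]
      exact Finset.mem_insert_of_mem (Finset.mem_insert_self _ _)
    rw [hf₁] at this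
    rcases Finset.mem_insert.1 this with h | h
    · exact hne h.symm
    · exact ha'τ (hB.1 h)
  have hd₂₃ : Disjoint ((Rq M τ q).image f₂) ((Rq M τ q).image f₃) := by
    rw [Finset.disjoint_left]
    intro S h1 h2
    rw [Finset.mem_image] at h1 h2
    obtain ⟨B, hB, rfl⟩ := h1
    obtain ⟨B', hB', hB'eq⟩ := h2
    rw [mem_Rq] at hB hB'
    have : a ∈ f₂ B := by
      rw [← hB'eq, hf₃]
      exact Finset.mem_insert_self _ _
    rw [hf₂] at this
    rcases Finset.mem_insert.1 this with h | h
    · exact hne h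
    · exact haτ (hB.1 h)
  -- the union of the images sits in `R_{q+1}(G)`
  have hsub : ((Rq M τ q).image f₁ ∪ (Rq M τ q).image f₂) ∪ (Rq M τ q).image f₃ ⊆ Rq M G (q + 1) := by
    intro S hS
    rw [Finset.mem_union, Finset.mem_union, Finset.mem_image, Finset.mem_image, Finset.mem_image] at hS
    rcases hS with (⟨B, hB, rfl⟩ | ⟨B, hB, rfl⟩) | ⟨B, hB, rfl⟩
    · exact hm₁ B hB
    · exact hm₂ B hB
    · exact hm₃ B hB
  have hd : Disjoint ((Rq M τ q).image f₁ ∪ (Rq M τ q).image f₂) ((Rq M τ q).image f₃) :=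
    Finset.disjoint_union_left.2 ⟨hd₁₃, hd₂₃⟩
  -- the per-`B″` share bounds
  have hw : ∀ B ∈ Rq M τ q, 4 * wInf M B ≤ 2 * wInf M (f₁ B) + 2 * wInf M (f₂ B) + 2 * wInf M (f₃ B) := by
    intro B hB
    rw [mem_Rq] at hB
    have hBτ := hB.1
    have haB : a ∉ B := fun h => haτ (hBτ h)
    have ha'B : a' ∉ B := fun h => ha'τ (hBτ h)
    have hm1 : (mTr M (f₁ B) : ℚ) ≤ mTr M B + 1 := by exact_mod_cast mTr_insert_le B a
    have hm2 : (mTr M (f₂ B) : ℚ) ≤ mTr M B + 1 := by exact_mod_cast mTr_insert_le B a'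
    have hr₃ : M.eRk ((insert a (insert a' B) : Finset α) : Set α) = (q : ℕ∞) + 1 := by
      have := hm₃ B (mem_Rq.2 hB)
      rw [mem_Rq] at this
      rw [this.2]
      push_cast
      rfl
    have hm3 : (mTr M (f₃ B) : ℚ) ≤ mTr M B := by
      have := mTr_insert_insert_le (M := M) ha ha' hne haB ha'B
        (by rw [hr₃, eRk_insert_of_notMem_closure ha' ha'cl hBτ hB.2])
        (by rw [hr₃, eRk_insert_of_notMem_closure ha hacl hBτ hB.2])
      exact_mod_cast this
    have hm0 : (0 : ℚ) ≤ mTr M B := by positivity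
    unfold wInf
    have e1 : 2 * (1 / (1 + (mTr M (f₁ B) : ℚ))) ≥ 1 / (1 + (mTr M B : ℚ)) := by
      rw [ge_iff_le, mul_one_div, div_le_div_iff₀ (by positivity) (by positivity)]
      linarith
    have e2 : 2 * (1 / (1 + (mTr M (f₂ B) : ℚ))) ≥ 1 / (1 + (mTr M B : ℚ)) := by
      rw [ge_iff_le, mul_one_div, div_le_div_iff₀ (by positivity) (by positivity)]
      linarith
    have e3 : 2 * (1 / (1 + (mTr M (f₃ B) : ℚ))) ≥ 2 * (1 / (1 + (mTr M B : ℚ))) := by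
      gcongr
    linarith
  -- assemble
  calc ∑ B ∈ Rq M τ q, 4 * wInf M B
      ≤ ∑ B ∈ Rq M τ q, (2 * wInf M (f₁ B) + 2 * wInf M (f₂ B) + 2 * wInf M (f₃ B)) :=
        Finset.sum_le_sum hw
    _ = ∑ B ∈ Rq M τ q, 2 * wInf M (f₁ B) + ∑ B ∈ Rq M τ q, 2 * wInf M (f₂ B) +
          ∑ B ∈ Rq M τ q, 2 * wInf M (f₃ B) := by
        rw [Finset.sum_add_distrib, Finset.sum_add_distrib]
    _ = ∑ S ∈ (Rq M τ q).image f₁, 2 * wInf M S + ∑ S ∈ (Rq M τ q).image f₂, 2 * wInf M S +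
          ∑ S ∈ (Rq M τ q).image f₃, 2 * wInf M S := by
        rw [Finset.sum_image hinj₁, Finset.sum_image hinj₂, Finset.sum_image hinj₃]
    _ = ∑ S ∈ ((Rq M τ q).image f₁ ∪ (Rq M τ q).image f₂) ∪ (Rq M τ q).image f₃, 2 * wInf M S := by
        rw [Finset.sum_union hd, Finset.sum_union hd₁₂]
    _ ≤ ∑ S ∈ Rq M G (q + 1), 2 * wInf M S := by
        apply Finset.sum_le_sum_of_subset_of_nonneg hsub
        intro S _ _
        exact mul_nonneg (by norm_num) (wInf_pos S).le

end HypAddTwo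

end PercRepro.GenQ
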